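import Literature.IUT.HodgeTheaters.ProfiniteCompletionCommensurablyTerminal
import HarnessLib

/-!
# [IUTchI] Prop. 2.2: all four typed clauses hold JOINTLY at a nondegenerate model (`ℍ := 𝔾`)

Mochizuki, *Inter-universal Teichmüller theory I: construction of Hodge theaters*, kurims manuscript
(May 2020), §2, Proposition 2.2 p. 45 ("`Π̂_ℍ ⊆ Π̂_𝔾` … `Π^tp_ℍ ⊆ Π̂_𝔾` are commensurably terminal … In
particular, `Π^tp_𝔾 ⊆ Π̂_𝔾` is commensurably terminal"), for "`ℍ ⊆ 𝔾` a [connected] sub-semi-graph"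
(p. 44 l. 36) [cite: Mochizuki2012, Prop 2.2 p.45] (D-0012 claim key; the series is DISPUTED in print;
nothing of it is asserted here).

PROOF-ONLY sequel (no definition, no new named fact) to this seat's
`ProfiniteCompletionCommensurablyTerminal.lean` / `FreeModelCommensuratorBoundary.lean` (FACT-LIST row
F-2590 `TemperedGraphGroupData.CommensuratorsOfDecompositionSubgroups`: clauses `tp_in_hat`, `tpH_in_tp`
PROVED at abc-iut-L5-d4's free consistency model `FreeModel.toy.graph` = `F₂ ↪ F̂₂` with
`Π^tp_ℍ := ⟨x₀⟩`; clause `tpH_in_hat` REFUTED there).  ERRATUM to that file's informal gloss "a joint model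
of the typed Prop. 2.2 needs nontrivial anabelioids": it does NOT.  Print allows `ℍ = 𝔾`; for ANY
𝔾-data with `Π^tp_ℍ = Π^tp_𝔾` and `Π̂_ℍ = Π̂_𝔾` the typed Prop. 2.2 is EQUIVALENT to its single
"in particular" clause (`TemperedGraphGroupData.prop22_iff_tp_in_hat_of_top`), and that clause holds at
`F₂ ↪ F̂₂` (a nonabelian free group of finite rank is commensurably terminal in its profinite
completion, `FreeModel.graph_tp_in_hat`).  Hence (`exists_nondegenerate_model_prop22`) the typed
predicate is JOINTLY SATISFIABLE — all four clauses at once — at a datum whose tempered group is an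
INFINITE NONABELIAN DISCRETE group injecting into a COMPACT group (`F₂ ↪ F̂₂`, `Π^tp_ℍ = Π^tp_𝔾`,
`Π̂_ℍ = Π̂_𝔾`), not merely at the trivial group.  Scope: satisfiability of OUR typed predicate at a
model; the genuine instance (special-fibre 𝔾-data of a curve, proper `ℍ ⊊ 𝔾`) is [SemiAnbd]-content
and is NOT touched; model ≠ genuine datum; typed ≠ discharged; nothing here bears on [IUTchIII]
Cor. 3.12.
-/

noncomputable section

namespace Literature.IUT.HodgeTheaters

open scoped Pointwise
open Literature.AnabelianGeometry.AbsoluteAnabelian (IsCommensurablyTerminal)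

/-! ### Prop. 2.2 for 𝔾-data with `Π^tp_ℍ = Π^tp_𝔾`, `Π̂_ℍ = Π̂_𝔾` -/

namespace TemperedGraphGroupData

universe u

variable (G : TemperedGraphGroupData.{u})

/-- `C_K(K) = K`: the full subgroup is commensurably terminal. [folklore] -/
private theorem isCommensurablyTerminal_top'' {K : Type*} [Group K] :
    IsCommensurablyTerminal (⊤ : Subgroup K) := by
  refine ⟨eq_top_iff.mpr fun g _ => ?_⟩
  rw [Subgroup.Commensurable.commensurator_mem_iff]
  have : ConjAct.toConjAct g • (⊤ : Subgroup K) = ⊤ :=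
    eq_top_iff.mpr fun x _ => by
      rw [Subgroup.mem_pointwise_smul_iff_inv_smul_mem]
      exact Subgroup.mem_top _
  rw [this]

/-- **Prop. 2.2 for 𝔾-data with `ℍ = 𝔾` ⇔ its "in particular" clause** ("`Π^tp_𝔾 ⊆ Π̂_𝔾` is
commensurably terminal"): the other three typed clauses are `C_G(G) = G`.
([IUTchI] Prop 2.2 p.45) [claim: Mochizuki2012, status: disputed] -/
theorem prop22_iff_tp_in_hat_of_top (hT : G.TpH = ⊤) (hH : G.HatH = ⊤) :
    G.CommensuratorsOfDecompositionSubgroups ↔ IsCommensurablyTerminal G.ι.range := by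
  refine ⟨fun h => h.tp_in_hat, fun h => ⟨?_, ?_, ?_, h⟩⟩
  · rw [hH]; exact isCommensurablyTerminal_top''
  · rw [hT, ← MonoidHom.range_eq_map]; exact h
  · rw [hT]; exact isCommensurablyTerminal_top''

end TemperedGraphGroupData

/-! ### The free consistency model with `ℍ := 𝔾` -/

namespace StableCurveTemperedData

namespace FreeModel

/-- The two free generators of `F₂` do not commute (seen in `𝔖₃` under `x₀ ↦ (0 1)`, `x₁ ↦ (1 2)`).
[folklore] -/
private theorem of_zero_mul_of_one_ne :
    (FreeGroup.of 0 * FreeGroup.of 1 : F2) ≠ (FreeGroup.of 1 * FreeGroup.of 0 : F2) := by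
  intro h
  have h' : (FreeGroup.of 0 * FreeGroup.of 1 : FreeGroup (Fin 2)) = FreeGroup.of 1 * FreeGroup.of 0 := h
  let f : FreeGroup (Fin 2) →* Equiv.Perm (Fin 3) := FreeGroup.lift ![Equiv.swap 0 1, Equiv.swap 1 2]
  have hf := congrArg f h'
  rw [map_mul, map_mul, FreeGroup.lift_apply_of, FreeGroup.lift_apply_of] at hf
  exact absurd hf (by decide)

/-- `F₂` is infinite (a nonabelian free-or-surface group is infinite). [folklore] -/
private theorem infinite_F2 : Infinite F2 :=
  isFreeOrSurface_F2.infinite_of_noncomm of_zero_mul_of_one_ne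

/-- **[IUTchI] Prop. 2.2 — ALL FOUR typed clauses — at the free model with `ℍ := 𝔾`** (`Π^tp_𝔾 = F₂`
discrete, `Π̂_𝔾 = F̂₂`, `Π^tp_ℍ := Π^tp_𝔾`, `Π̂_ℍ := Π̂_𝔾`): the 𝔾-data `FreeModel.graph` with its two
`ℍ`-parameters replaced by `⊤` satisfies `CommensuratorsOfDecompositionSubgroups`.
([IUTchI] Prop 2.2 p.45) [claim: Mochizuki2012, status: disputed] -/
theorem prop22_graph_wholeGraph :
    ({ toy.graph with TpH := ⊤, HatH := ⊤, tpH_le := le_top } :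
        TemperedGraphGroupData.{0}).CommensuratorsOfDecompositionSubgroups :=
  (TemperedGraphGroupData.prop22_iff_tp_in_hat_of_top _ rfl rfl).mpr graph_tp_in_hat

/-- **F-2590 is JOINTLY SATISFIABLE at a NONDEGENERATE datum** (erratum to the informal gloss of
`FreeModelCommensuratorBoundary.lean`): there is a `TemperedGraphGroupData` whose tempered group
`Π^tp_𝔾` is an infinite, nonabelian, discrete group, whose map `Π^tp_𝔾 → Π̂_𝔾` into the compact `Π̂_𝔾`
is injective, with `Π^tp_ℍ = Π^tp_𝔾` and `Π̂_ℍ = Π̂_𝔾`, at which ALL FOUR clauses of the typed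
Prop. 2.2 hold.  Witness: `F₂ ↪ F̂₂` with `ℍ := 𝔾`. ([IUTchI] Prop 2.2 p.45) [claim: Mochizuki2012, status: disputed] -/
theorem exists_nondegenerate_model_prop22 :
    ∃ G : TemperedGraphGroupData.{0},
      G.CommensuratorsOfDecompositionSubgroups ∧ DiscreteTopology G.Tp ∧ Infinite G.Tp ∧
        (∃ a b : G.Tp, a * b ≠ b * a) ∧ Function.Injective G.ι ∧ G.TpH = ⊤ ∧ G.HatH = ⊤ :=
  ⟨{ toy.graph with TpH := ⊤, HatH := ⊤, tpH_le := le_top }, prop22_graph_wholeGraph,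
    inferInstanceAs (DiscreteTopology F2), infinite_F2, ⟨_, _, of_zero_mul_of_one_ne⟩, ι_injective,
    rfl, rfl⟩

end FreeModel

end StableCurveTemperedData

end Literature.IUT.HodgeTheaters

end
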